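import Summits.HodgeConjecture.HodgeConjecture.Theorems.Ring2AbelianAllNonsplitNormObstruction
import HarnessLib

/-!
# A uniform non-norm criterion for `ℚ(√-d)` by `p`-descent, and the non-split certificates of the g = 6 Weil-type census

research route conditional on HC_CM; not a corollary; Q11.4-sentence-2 already refuted in dim ≥ 3.

Cell `pub-hodge-ring2`, binder seat `ring2-b02` (gen 49), WEIL-TYPE FAMILY-COVERAGE CENSUS
(`run/shared/lean/pub/pub-hodge-ring2/WEIL-FAMILY-COVERAGE.md` §b02). The components of the moduli of polarized
abelian `2n`-folds of Weil type with field `K = ℚ(√-d)` are indexed, up to isogeny, by the class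
`δ = det H ∈ ℚˣ/Nm(Kˣ)` of van Geemen's Hermitian form (LNM 1594, Lemma 5.2 (3), 5.4 and (5.4.1) after Landherr:
`det H = (-1)ⁿ a`, `a ∈ ℚ_{>0}`, and `H` is hyperbolic — the component is SPLIT — iff `a ∈ Nm(Kˣ)`; tree:
`VanGeemen1994.weilNormResidueGroup d`, `Ring2.Hypotheses.splitDiscriminantClass n d = [(-1)ⁿ]`). The census table
lists, for every imaginary quadratic `K` of the target fields and every class, its least square-free representative
`a`; that a row is NON-split is the arithmetic statement `a ∉ Nm(Kˣ)`. So far the tree certified exactly one such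
statement (`Ring2AbelianAll.NonsplitNormObstruction.two_not_mem_normUnitsSubgroup`, `2 ∉ Nm(ℚ(√-3)ˣ)`, by an ad hoc
descent at `3`). This file proves the GENERAL descent criterion once and instantiates it on every non-split row of the
five target fields `ℚ(i), ℚ(√-2), ℚ(√-3), ℚ(√-7), ℚ(√-11)` of pub-hsemireg's TARGET-TABLE (rows R1–R4).

## What is proved (0 sorry, no `def`, no named fact; `HC_CM` does not occur)

* `descent_eq_zero` — if at the prime `p` the binary form `x² + d y²` satisfies
  (H1) `p ∣ x² + d y² → p² ∣ x² + d y²` and (H3) `p³ ∣ x² + d y² → p ∣ x ∧ p ∣ y` (all `x y : ℤ`), then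
  `x² + d y² = p·u·D²` with `p ∤ u` forces `D = 0` (infinite descent on `|D|`).
* `descent_hyps_of_anisotropic` — (H1) ∧ (H3) hold when `x² + d y²` is anisotropic over `ZMod p`, in particular
  (`anisotropic_of_forall_sq_ne`) when `-d` is not a square mod the prime `p` (`p` inert in `K`, `p` odd);
  `descent_hyps_two` — (H1) ∧ (H3) hold at `p = 2` when `d ≡ 3 (mod 8)` (`2` inert), by a mod-`8` analysis.
* `not_exists_rat_sq_add_mul_sq`, `natCast_not_mem_normUnitsSubgroup` — under (H1) ∧ (H3): `p·u ∉ Nm(ℚ(√-d)ˣ)` for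
  `p ∤ u` (`Nm(a + b√-d) = a² + d b²`, ab-weil-1's `norm_weilField_mk`); i.e. the local obstruction "`v_p(a)` odd at an
  inert prime `p`" of the census, kernel-checked.
* `mk_neg_ne_splitDiscriminantClass_of_odd` / `mk_ne_splitDiscriminantClass_of_even` — a non-norm `a` gives a
  non-split class: `[-a] ≠ [(-1)ⁿ]` for odd `n` (sixfolds, tenfolds), `[a] ≠ [(-1)ⁿ]` for even `n` (eightfolds).
* The CERTIFICATES for the census rows (`ℚ(i)`: `3, 7, 21`; `ℚ(√-2)`: `5, 7, 13`; `ℚ(√-3)`: `2, 5, 10, 11, 22`;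
  `ℚ(√-7)`: `3, 5, 13`; `ℚ(√-11)`: `2, 7`) are the companion file `Ring2WeilNormObstructionDescentCensus`.

Method: textbook (`p`-adic valuation of a norm from `ℚ_p(√-d)`, `p` inert, is even; here as an integer descent so that
no valuation API is needed). Nothing here is a statement about Hodge classes.

## References

* [vanGeemen1994HodgeAV] B. van Geemen, An introduction to the Hodge conjecture for abelian varieties, LNM 1594
  (1994), 4.14, Lemma 5.2 (3), 5.4, (5.4.1) (p. 223: "with `a ∈ ℚ_{>0}` (see [L])", [L] = Landherr 1936).
* [Markman2025SecantWeil] E. Markman, arXiv:2502.03415 (preprint), §1 p. 3 (the invariant `(n, K, det H)`) — context only.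
-/

noncomputable section

open Polynomial
open Literature.AlgebraicGeometry.Motives
open Literature.AlgebraicGeometry.VanGeemen1994
open Summit.HodgeConjecture.HodgeConjecture.Ring2.Hypotheses
open Summit.HodgeConjecture.HodgeConjecture.Ring2.AbelianAll

namespace Summit.HodgeConjecture.Ring2WeilNormDescent

/-! ### §1 The descent engine -/

/-- **Descent.** If the form `x² + d y²` satisfies (H1) `p ∣ Q → p² ∣ Q` and (H3) `p³ ∣ Q → p ∣ x ∧ p ∣ y` at the prime
`p`, then an integer identity `x² + d y² = p·u·D²` with `p ∤ u` forces `D = 0`: from (H1) `p ∣ D`, then `p³ ∣ Q`, so by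
(H3) `p ∣ x, y`, and `(x/p, y/p, D/p)` is a smaller solution.
research route conditional on HC_CM; not a corollary; Q11.4-sentence-2 already refuted in dim ≥ 3. [folklore] -/
theorem descent_eq_zero {p d : ℕ} (hp : p.Prime) {u : ℤ} (hu : ¬ (p : ℤ) ∣ u)
    (hH1 : ∀ x y : ℤ, (p : ℤ) ∣ x ^ 2 + (d : ℤ) * y ^ 2 → (p : ℤ) ^ 2 ∣ x ^ 2 + (d : ℤ) * y ^ 2)
    (hH3 : ∀ x y : ℤ, (p : ℤ) ^ 3 ∣ x ^ 2 + (d : ℤ) * y ^ 2 → (p : ℤ) ∣ x ∧ (p : ℤ) ∣ y) :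
    ∀ (n : ℕ) (x y D : ℤ), D.natAbs = n → x ^ 2 + (d : ℤ) * y ^ 2 = p * u * D ^ 2 → D = 0 := by
  have hpZ : Prime (p : ℤ) := Nat.prime_iff_prime_int.mp hp
  have hp0 : (p : ℤ) ≠ 0 := by exact_mod_cast hp.ne_zero
  intro n
  induction n using Nat.strong_induction_on with
  | _ n ih =>
    intro x y D hn h
    by_contra hD
    have h1 : (p : ℤ) ∣ x ^ 2 + (d : ℤ) * y ^ 2 := ⟨u * D ^ 2, by rw [h]; ring⟩
    have h2 := hH1 x y h1
    rw [h] at h2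
    have h3 : (p : ℤ) ∣ u * D ^ 2 := by
      have h2' : (p : ℤ) * p ∣ (p : ℤ) * (u * D ^ 2) := by
        have e1 : (p : ℤ) ^ 2 = p * p := sq _
        have e2 : (p : ℤ) * u * D ^ 2 = p * (u * D ^ 2) := mul_assoc _ _ _
        rwa [e1, e2] at h2
      exact (mul_dvd_mul_iff_left hp0).1 h2'
    have h4 : (p : ℤ) ∣ D := by
      rcases hpZ.dvd_or_dvd h3 with h5 | h5
      · exact absurd h5 hu
      · exact hpZ.dvd_of_dvd_pow h5
    obtain ⟨D', hD'⟩ := h4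
    have h5 : (p : ℤ) ^ 3 ∣ x ^ 2 + (d : ℤ) * y ^ 2 := ⟨u * D' ^ 2, by rw [h, hD']; ring⟩
    obtain ⟨⟨x', hx'⟩, ⟨y', hy'⟩⟩ := hH3 x y h5
    have h6 : x' ^ 2 + (d : ℤ) * y' ^ 2 = p * u * D' ^ 2 := by
      have h7 : (p : ℤ) ^ 2 * (x' ^ 2 + (d : ℤ) * y' ^ 2) = (p : ℤ) ^ 2 * (p * u * D' ^ 2) := by
        have h8 := h
        rw [hx', hy', hD'] at h8
        linear_combination h8
      exact mul_left_cancel₀ (pow_ne_zero 2 hp0) h7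
    have hD'0 : D' ≠ 0 := by
      rintro rfl
      exact hD (by rw [hD', mul_zero])
    have hlt : D'.natAbs < n := by
      rw [← hn, hD', Int.natAbs_mul, Int.natAbs_natCast]
      have hpos : 0 < D'.natAbs := Int.natAbs_pos.2 hD'0
      have hp2 : 2 ≤ p := hp.two_le
      nlinarith
    exact hD'0 (ih _ hlt x' y' D' rfl h6)

/-- **No rational solution of `a² + d b² = p·u`** (`p ∤ u`) under (H1) ∧ (H3): clear denominators and descend.
research route conditional on HC_CM; not a corollary; Q11.4-sentence-2 already refuted in dim ≥ 3. [folklore] -/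
theorem not_exists_rat_sq_add_mul_sq {p d : ℕ} (hp : p.Prime) {u : ℤ} (hu : ¬ (p : ℤ) ∣ u)
    (hH1 : ∀ x y : ℤ, (p : ℤ) ∣ x ^ 2 + (d : ℤ) * y ^ 2 → (p : ℤ) ^ 2 ∣ x ^ 2 + (d : ℤ) * y ^ 2)
    (hH3 : ∀ x y : ℤ, (p : ℤ) ^ 3 ∣ x ^ 2 + (d : ℤ) * y ^ 2 → (p : ℤ) ∣ x ∧ (p : ℤ) ∣ y) :
    ¬ ∃ a b : ℚ, a ^ 2 + (d : ℚ) * b ^ 2 = (p : ℚ) * u := by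
  rintro ⟨a, b, h⟩
  have hz : ((a.den : ℤ) * b.den) ≠ 0 :=
    mul_ne_zero (Int.natCast_ne_zero.2 a.den_nz) (Int.natCast_ne_zero.2 b.den_nz)
  have key : (a.num * b.den : ℤ) ^ 2 + (d : ℤ) * (b.num * a.den) ^ 2 =
      p * u * ((a.den : ℤ) * b.den) ^ 2 := by
    have ha := Rat.mul_den_eq_num a
    have hb := Rat.mul_den_eq_num b
    have hq : ((a.num * b.den : ℤ) : ℚ) ^ 2 + (d : ℚ) * ((b.num * a.den : ℤ) : ℚ) ^ 2 =
        (p : ℚ) * u * (((a.den : ℤ) * b.den : ℤ) : ℚ) ^ 2 := by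
      push_cast
      rw [← ha, ← hb]
      linear_combination ((a.den : ℚ) * b.den) ^ 2 * h
    exact_mod_cast hq
  exact hz (descent_eq_zero hp hu hH1 hH3 _ _ _ _ rfl key)

/-- **Non-norm criterion.** Under (H1) ∧ (H3) at `p`: a natural number `a` with `p ∣ a`, `p² ∤ a` is NOT a norm from
`K_d = ℚ(√-d)` — `a ∉ Nm(K_dˣ)` (`Motives.normUnitsSubgroup`; `Nm(x + y√-d) = x² + d y²`). This is the census's local
obstruction "`p ∈ T(a)`" at an anisotropic prime, kernel-checked.
research route conditional on HC_CM; not a corollary; Q11.4-sentence-2 already refuted in dim ≥ 3. [cite: vanGeemen1994HodgeAV, 4.14 and (5.4.1)] -/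
theorem natCast_not_mem_normUnitsSubgroup {p d a : ℕ} (hp : p.Prime) (hpa : p ∣ a) (hpa2 : ¬ p ^ 2 ∣ a)
    (hH1 : ∀ x y : ℤ, (p : ℤ) ∣ x ^ 2 + (d : ℤ) * y ^ 2 → (p : ℤ) ^ 2 ∣ x ^ 2 + (d : ℤ) * y ^ 2)
    (hH3 : ∀ x y : ℤ, (p : ℤ) ^ 3 ∣ x ^ 2 + (d : ℤ) * y ^ 2 → (p : ℤ) ∣ x ∧ (p : ℤ) ∣ y)
    (h0 : (a : ℚ) ≠ 0) :
    Units.mk0 (a : ℚ) h0 ∉ normUnitsSubgroup ℚ (weilField d) := by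
  obtain ⟨u, rfl⟩ := hpa
  have hu : ¬ (p : ℤ) ∣ (u : ℤ) := by
    intro h
    have h' : p ∣ u := by exact_mod_cast h
    exact hpa2 (by rw [sq]; exact mul_dvd_mul_left p h')
  intro hmem
  obtain ⟨k, hk⟩ := mem_normUnitsSubgroup_iff.1 hmem
  obtain ⟨x, y, hxy⟩ := exists_eq_mk_linear d (k : weilField d)
  have hn := norm_weilField_mk d x y
  rw [← hxy, hk] at hn
  refine not_exists_rat_sq_add_mul_sq hp hu hH1 hH3 ⟨x, y, ?_⟩
  rw [← hn]
  push_cast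
  rfl

/-! ### §2 Supplying (H1) ∧ (H3): anisotropic primes and `p = 2`, `d ≡ 3 (mod 8)` -/

/-- If `x² + d y²` is anisotropic over `ZMod p` then `p ∣ x² + d y²` forces `p ∣ x` and `p ∣ y`.
research route conditional on HC_CM; not a corollary; Q11.4-sentence-2 already refuted in dim ≥ 3. [folklore] -/
theorem dvd_and_dvd_of_anisotropic {p d : ℕ}
    (hA : ∀ x y : ZMod p, x ^ 2 + (d : ZMod p) * y ^ 2 = 0 → x = 0 ∧ y = 0)
    {x y : ℤ} (h : (p : ℤ) ∣ x ^ 2 + (d : ℤ) * y ^ 2) : (p : ℤ) ∣ x ∧ (p : ℤ) ∣ y := by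
  have hz : ((x : ZMod p)) ^ 2 + (d : ZMod p) * ((y : ZMod p)) ^ 2 = 0 := by
    have h' := (ZMod.intCast_zmod_eq_zero_iff_dvd (x ^ 2 + (d : ℤ) * y ^ 2) p).2 h
    push_cast at h'
    exact h'
  obtain ⟨hx, hy⟩ := hA _ _ hz
  exact ⟨(ZMod.intCast_zmod_eq_zero_iff_dvd x p).1 hx, (ZMod.intCast_zmod_eq_zero_iff_dvd y p).1 hy⟩

/-- **(H1) ∧ (H3) at an anisotropic prime** (`p ∣ Q ⇒ p ∣ x, p ∣ y ⇒ p² ∣ Q`).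
research route conditional on HC_CM; not a corollary; Q11.4-sentence-2 already refuted in dim ≥ 3. [folklore] -/
theorem descent_hyps_of_anisotropic {p d : ℕ}
    (hA : ∀ x y : ZMod p, x ^ 2 + (d : ZMod p) * y ^ 2 = 0 → x = 0 ∧ y = 0) :
    (∀ x y : ℤ, (p : ℤ) ∣ x ^ 2 + (d : ℤ) * y ^ 2 → (p : ℤ) ^ 2 ∣ x ^ 2 + (d : ℤ) * y ^ 2) ∧
      (∀ x y : ℤ, (p : ℤ) ^ 3 ∣ x ^ 2 + (d : ℤ) * y ^ 2 → (p : ℤ) ∣ x ∧ (p : ℤ) ∣ y) := by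
  refine ⟨fun x y h => ?_, fun x y h => dvd_and_dvd_of_anisotropic hA ((dvd_pow_self _ three_ne_zero).trans h)⟩
  obtain ⟨⟨x', hx⟩, ⟨y', hy⟩⟩ := dvd_and_dvd_of_anisotropic hA h
  exact ⟨x' ^ 2 + (d : ℤ) * y' ^ 2, by rw [hx, hy]; ring⟩

/-- **Anisotropy from a non-residue**: over the field `ZMod p`, if `-d` is not a square then `x² + d y² = 0` only
trivially (else `(x/y)² = -d`). For `p` odd, `p ∤ d`, this is "`p` is inert in `ℚ(√-d)`".
research route conditional on HC_CM; not a corollary; Q11.4-sentence-2 already refuted in dim ≥ 3. [folklore] -/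
theorem anisotropic_of_forall_sq_ne {p d : ℕ} [Fact p.Prime] (hns : ∀ t : ZMod p, t ^ 2 ≠ -(d : ZMod p)) :
    ∀ x y : ZMod p, x ^ 2 + (d : ZMod p) * y ^ 2 = 0 → x = 0 ∧ y = 0 := by
  intro x y h
  by_cases hy : y = 0
  · subst hy
    have hx : x ^ 2 = 0 := by simpa using h
    exact ⟨pow_eq_zero_iff (two_ne_zero) |>.1 hx, rfl⟩
  · exfalso
    have hy2 : y ^ 2 ≠ 0 := pow_ne_zero _ hy
    have hx2 : x ^ 2 = -(d : ZMod p) * y ^ 2 := by linear_combination h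
    apply hns (x * y⁻¹)
    calc (x * y⁻¹) ^ 2 = x ^ 2 * (y ^ 2)⁻¹ := by rw [mul_pow, inv_pow]
      _ = -(d : ZMod p) * y ^ 2 * (y ^ 2)⁻¹ := by rw [hx2]
      _ = -(d : ZMod p) := by rw [mul_assoc, mul_inv_cancel₀ hy2, mul_one]

/-- **The `2`-adic trichotomy for `d ≡ 3 (mod 8)`**: for integers `x, y`, either both are even, or `x² + d y²` is odd,
or `x² + d y² ≡ 4 (mod 8)` (both odd: `1 + d ≡ 4`). Hence the `2`-adic valuation of a non-trivial value is even.
research route conditional on HC_CM; not a corollary; Q11.4-sentence-2 already refuted in dim ≥ 3. [folklore] -/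
theorem two_adic_trichotomy {d : ℕ} (hd : d % 8 = 3) (x y : ℤ) :
    ((2 : ℤ) ∣ x ∧ (2 : ℤ) ∣ y) ∨ ¬ (2 : ℤ) ∣ x ^ 2 + (d : ℤ) * y ^ 2 ∨ (x ^ 2 + (d : ℤ) * y ^ 2) % 8 = 4 := by
  obtain ⟨e, he⟩ : ∃ e : ℕ, d = 8 * e + 3 := ⟨d / 8, by omega⟩
  have hdZ : (d : ℤ) = 8 * (e : ℤ) + 3 := by rw [he]; push_cast; ring
  obtain ⟨k, hk | hk⟩ := Int.even_or_odd' x <;> obtain ⟨l, hl | hl⟩ := Int.even_or_odd' y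
  · exact Or.inl ⟨⟨k, hk⟩, ⟨l, hl⟩⟩
  · refine Or.inr (Or.inl ?_)
    rintro ⟨c, hc⟩
    have h' : x ^ 2 + (d : ℤ) * y ^ 2 = 2 * (2 * k ^ 2 + (8 * e + 3) * (2 * l ^ 2 + 2 * l) + 4 * e + 1) + 1 := by
      rw [hk, hl, hdZ]; ring
    omega
  · refine Or.inr (Or.inl ?_)
    rintro ⟨c, hc⟩
    have h' : x ^ 2 + (d : ℤ) * y ^ 2 = 2 * (2 * k ^ 2 + 2 * k + (8 * e + 3) * (2 * l ^ 2)) + 1 := by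
      rw [hk, hl, hdZ]; ring
    omega
  · refine Or.inr (Or.inr ?_)
    obtain ⟨m, hm⟩ := Int.even_mul_succ_self k
    obtain ⟨m', hm'⟩ := Int.even_mul_succ_self l
    have h' : x ^ 2 + (d : ℤ) * y ^ 2 = 8 * (m + (8 * e + 3) * m' + e) + 4 := by
      rw [hk, hl, hdZ]
      linear_combination (4 : ℤ) * hm + (4 : ℤ) * (8 * (e : ℤ) + 3) * hm'
    omega

/-- **(H1) ∧ (H3) at `p = 2` for `d ≡ 3 (mod 8)`** (`2` inert in `ℚ(√-d)`): `2 ∣ Q ⇒ 4 ∣ Q`, and `8 ∣ Q ⇒ x, y` even.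
research route conditional on HC_CM; not a corollary; Q11.4-sentence-2 already refuted in dim ≥ 3. [folklore] -/
theorem descent_hyps_two {d : ℕ} (hd : d % 8 = 3) :
    (∀ x y : ℤ, ((2 : ℕ) : ℤ) ∣ x ^ 2 + (d : ℤ) * y ^ 2 → ((2 : ℕ) : ℤ) ^ 2 ∣ x ^ 2 + (d : ℤ) * y ^ 2) ∧
      (∀ x y : ℤ, ((2 : ℕ) : ℤ) ^ 3 ∣ x ^ 2 + (d : ℤ) * y ^ 2 → ((2 : ℕ) : ℤ) ∣ x ∧ ((2 : ℕ) : ℤ) ∣ y) := by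
  refine ⟨fun x y h => ?_, fun x y h => ?_⟩
  · have h2 : (2 : ℤ) ∣ x ^ 2 + (d : ℤ) * y ^ 2 := by exact_mod_cast h
    have h4 : (4 : ℤ) ∣ x ^ 2 + (d : ℤ) * y ^ 2 := by
      rcases two_adic_trichotomy hd x y with ⟨⟨k, hk⟩, ⟨l, hl⟩⟩ | hodd | h8
      · exact ⟨k ^ 2 + (d : ℤ) * l ^ 2, by rw [hk, hl]; ring⟩
      · exact absurd h2 hodd
      · omega
    have e4 : ((2 : ℕ) : ℤ) ^ 2 = 4 := by norm_num
    rw [e4]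
    exact h4
  · have h8 : (8 : ℤ) ∣ x ^ 2 + (d : ℤ) * y ^ 2 := by
      have e8 : ((2 : ℕ) : ℤ) ^ 3 = 8 := by norm_num
      rw [e8] at h
      exact h
    rcases two_adic_trichotomy hd x y with ⟨hx, hy⟩ | hodd | h4
    · exact ⟨by exact_mod_cast hx, by exact_mod_cast hy⟩
    · exact absurd (dvd_trans ⟨4, by norm_num⟩ h8) hodd
    · omega

/-! ### §3 From a non-norm to a non-split class -/

/-- **Odd `n` (sixfolds, tenfolds): `a ∉ Nm(K_dˣ)` ⇒ `[-a] ≠ [(-1)ⁿ] = [-1]`** — the class `δ = det H = -a` of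
van Geemen's normal form `diag(a, 1, …, 1, -1, …, -1)` is not the split class.
research route conditional on HC_CM; not a corollary; Q11.4-sentence-2 already refuted in dim ≥ 3. [cite: vanGeemen1994HodgeAV, 5.4 and (5.4.1)] -/
theorem mk_neg_ne_splitDiscriminantClass_of_odd {d : ℕ} {a : ℚ} (ha : a ≠ 0)
    (hN : Units.mk0 a ha ∉ normUnitsSubgroup ℚ (weilField d)) {n : ℕ} (hn : Odd n) :
    (QuotientGroup.mk (Units.mk0 (-a) (neg_ne_zero.2 ha)) : weilNormResidueGroup d) ≠
      splitDiscriminantClass n d := by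
  intro h
  rw [splitDiscriminantClass, hn.neg_one_pow, QuotientGroup.eq] at h
  have hu : (Units.mk0 (-a) (neg_ne_zero.2 ha))⁻¹ * (-1 : ℚˣ) = (Units.mk0 a ha)⁻¹ := by
    ext
    simp [inv_neg]
  rw [hu] at h
  exact hN (by simpa using Subgroup.inv_mem _ h)

/-- **Even `n` (fourfolds, eightfolds): `a ∉ Nm(K_dˣ)` ⇒ `[a] ≠ [(-1)ⁿ] = [1]`.**
research route conditional on HC_CM; not a corollary; Q11.4-sentence-2 already refuted in dim ≥ 3. [cite: vanGeemen1994HodgeAV, 5.4 and (5.4.1)] -/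
theorem mk_ne_splitDiscriminantClass_of_even {d : ℕ} {a : ℚ} (ha : a ≠ 0)
    (hN : Units.mk0 a ha ∉ normUnitsSubgroup ℚ (weilField d)) {n : ℕ} (hn : Even n) :
    (QuotientGroup.mk (Units.mk0 a ha) : weilNormResidueGroup d) ≠ splitDiscriminantClass n d := by
  intro h
  rw [splitDiscriminantClass, hn.neg_one_pow, QuotientGroup.eq, mul_one] at h
  exact hN (by simpa using Subgroup.inv_mem _ h)

end Summit.HodgeConjecture.Ring2WeilNormDescent

end
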